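import Literature.Computability.QuantumComplexity.OraclePolynomialMethod
import Literature.Computability.QuantumComplexity.AaronsonAmbainisSimTreeBounds
import Literature.Computability.Cryptography.QuantumCircuitProofs
import Literature.Computability.Complexity.DiagPrelims
import Literature.Computability.Complexity.BinarySubtraction
import HarnessLib

/-!
# Aaronson–Ambainis 2014, Thm. 23: the query-efficient simulation of a `BQP^A` machine on a random oracle

The proof of Aaronson–Ambainis' Thm. 23 (arXiv:0911.0996v3, p. 14; the tree fact
`aaronsonAmbainis2014_thm23_apx` of `AaronsonAmbainisThm23.lean` vendors its claim (apx))
combines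

1. Lemma 20 for the oracle machine `Q` — "`p_x(A)` depends only on some finite prefix `B` of `A`
   … `p_x` is a polynomial in the bits of `B`" (tree: `exists_acceptPolynomialOn`,
   `OraclePolynomialMethod.lean`);
2. Thm. 21 — "`C` is essentially just the algorithm from Theorem 21", run on `p_x` with
   `ε = 1/10` and `δ < 1/n³`, so that `Pr_A[|p̃_x(A) − p_x(A)| > 1/10] < 1/n³` with `poly(n)`
   QUERIES to `A` (tree: `ClassicalSimulation.simTree` of `AaronsonAmbainisProofs.lean`, packaged
   for an abstract polynomial as `ClassicalSimulation.exists_simTree_of_AAConjecture`,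
   `AaronsonAmbainisSimTreeBounds.lean`);
3. the implementation of `C` in polynomial TIME under `P = P^{#P}` (coefficients in `P^{#P}`,
   `Vr`/`Inf` in the counting hierarchy, which collapses) — NOT in the tree.

This file proves **1 + 2**, i.e. claim (apx) with "queries" in place of "computation steps":

* `oracleWidth F x = |x| + ancillas |x|`, `numOracleBits` (`M = |shortStrings width| = 2^width − 1`,
  `card_shortStrings`), `bitEquiv` (`OracleVar width ≃ Fin M`, the EXPLICIT numbering
  `strNum s = 2^{|s|} − 1 + val s` — variable `i` is a definite string, so that the tree's
  least-index rule is machine-implementable), `oracleBits F x A : Fin M → Bool` (the relevant bits of `A`,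
  `restrictBool` enumerated), `oracleOf` (a right inverse), `acceptPoly F x : MvPolynomial (Fin M) ℝ` with
  `evalBool (acceptPoly F x) (oracleBits F x A) = F.acceptProbOn A x` (`evalBool_acceptPoly`),
  degree `≤ 2 · #oracle gates` and values in `[0, 1]` (unitary gate set);
* `randomOracleMeasure_oracleBits_mem` — the random oracle's relevant bits are uniform
  (bridge `randomOracleMeasure_restrictBool`);
* **`simTreeOn c C₀ F x`** — the EXPLICIT simulation tree of `F` at `x` (the printed `C` run on
  `p_x` with `ε = 1/10`, `δ = thm23Delta x = 1/(2n³)`, `d = thm23Degree F x`), for constants `c, C₀`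
  of Conjecture 6; `simTreeOn_depth_error_le` (depth `≤ (⌈16·4^c/C₀⌉+1)·61^{4c+2}·(size + n)^{4(4c+2)}`,
  few bad bit patterns), **`measure_simTreeOn_deviation_lt`** (`μ {A : |p̃_x(A) − p_x(A)| > 1/10} < 1/n³`)
  and `measure_simTreeOn_threshold_lt` (the `BQP`-promise event of `aaronsonAmbainis2014_thm23_apx`
  for the thresholded output `[p̃_x(A) ≥ 1/2]`);
* `aaronsonAmbainis2014_thm23_queries`, `aaronsonAmbainis2014_thm23_queries_threshold` — the
  packaged forms under `AAConjecture` (`∃ C k, ∀ F x, ∃` tree of depth `≤ C (size + n)^k …`).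
  What remains of (apx) is exactly the polynomial-TIME implementability (under `P = P^{#P}`, for
  uniform `F`) of `A, x ↦ [ (simTreeOn c C₀ F x).eval (oracleBits F x A) ≥ 1/2 ]`.

## References

* [AaronsonAmbainis2014] arXiv:0911.0996v3, Thm. 23 and its proof (p. 14), Thm. 21, Lemma 20
  (p. 13), Cor. 22 (thresholding at `1/2`).
-/

noncomputable section

namespace Literature.Computability.QuantumComplexity

open Finset MeasureTheory Literature.Computability.Cryptography Literature.Computability.Complexity
open scoped ENNReal

variable {G : QGateSet}

/-! ### The relevant oracle bits and the acceptance polynomial over them -/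

section Bits

variable (F : QCircuitFamily G) (x : List Bool)

/-- The width of the run of `F` on `x` (input wires plus ancillas); the oracle strings a run can
query are those of length `< width` (`shortStrings`, `OracleVar`). [cite: AaronsonAmbainis2014, proof of Thm. 23 (the finite prefix B)] -/
abbrev oracleWidth : ℕ := x.length + F.ancillas x.length

/-- The number `M` of relevant oracle bits (the printed `N = 2^{poly(n)}`). [cite: AaronsonAmbainis2014, proof of Thm. 23] -/
def numOracleBits : ℕ := (shortStrings (oracleWidth F x)).card

/-- **The canonical numbering of strings** ("bijective base 2"): `s ↦ val (s·1) − 1`, i.e.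
`2^{|s|} − 1 + val s` with `val` the little-endian binary value (`bitsToNat`); the strings of
length `< W` are numbered `0, …, 2^W − 2`, by length and then by value. An EXPLICIT enumeration
(unlike `Finset.equivFin`), so that the simulation tree below — which queries the least
influential variable — is a definite algorithm a machine can implement (proof of Thm. 23, p. 14:
"we can implement `C` using … `poly(n)` computation steps"). [folklore] -/
def strNum (s : List Bool) : ℕ := bitsToNat (s ++ [true]) - 1

/-- `strNum s + 1 = val (s·1)` (no truncation in the subtraction). [folklore] -/
theorem strNum_add_one (s : List Bool) : strNum s + 1 = bitsToNat (s ++ [true]) := by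
  unfold strNum; rw [bitsToNat_append_true]; have := Nat.one_le_two_pow (n := s.length); omega

/-- `strNum s = 2^{|s|} − 1 + val s`. [folklore] -/
theorem strNum_eq (s : List Bool) : strNum s = 2 ^ s.length - 1 + bitsToNat s := by
  unfold strNum; rw [bitsToNat_append_true]; have := Nat.one_le_two_pow (n := s.length); omega

/-- The range of the numbering on strings of length `ℓ`: `2^ℓ − 1 ≤ strNum s < 2^{ℓ+1} − 1`. [folklore] -/
theorem strNum_lt (s : List Bool) : strNum s < 2 ^ (s.length + 1) - 1 := by
  rw [strNum_eq, pow_succ]; have := bitsToNat_lt s; have := Nat.one_le_two_pow (n := s.length); omega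

/-- Lower end of the range. [folklore] -/
theorem le_strNum (s : List Bool) : 2 ^ s.length - 1 ≤ strNum s := by
  rw [strNum_eq]; omega

/-- Strings of length `< W` are numbered below `2^W − 1`. [folklore] -/
theorem strNum_lt_of_length_lt {s : List Bool} {W : ℕ} (h : s.length < W) : strNum s < 2 ^ W - 1 :=
  (strNum_lt s).trans_le (Nat.sub_le_sub_right (Nat.pow_le_pow_right (by norm_num) h) 1)

/-- The numbering determines the length. [folklore] -/
theorem length_eq_of_strNum_eq {s t : List Bool} (h : strNum s = strNum t) : s.length = t.length := by
  have hs := strNum_lt s; have hs' := le_strNum s; have ht := strNum_lt t; have ht' := le_strNum t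
  by_contra hne
  rcases Nat.lt_or_gt_of_ne hne with hlt | hlt
  · have : 2 ^ (s.length + 1) ≤ 2 ^ t.length := Nat.pow_le_pow_right (by norm_num) hlt
    omega
  · have : 2 ^ (t.length + 1) ≤ 2 ^ s.length := Nat.pow_le_pow_right (by norm_num) hlt
    omega

/-- **The numbering is injective** (equal numbers force equal lengths, then equal values, and
`val` is injective at fixed length). [folklore] -/
theorem strNum_injective : Function.Injective strNum := by
  intro s t h
  have hlen := length_eq_of_strNum_eq h
  have hval : bitsToNat s = bitsToNat t := by
    have h' := h; rw [strNum_eq, strNum_eq, hlen] at h'; omega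
  exact DiagPrelims.eq_of_bitsToNat_eq hlen hval

/-- `Σ_{ℓ<W} 2^ℓ = 2^W − 1`. [folklore] -/
theorem sum_range_two_pow (W : ℕ) : ∑ n ∈ Finset.range W, 2 ^ n = 2 ^ W - 1 := by
  induction W with
  | zero => simp
  | succ W ih => rw [Finset.sum_range_succ, ih, pow_succ]; have := Nat.one_le_two_pow (n := W); omega

/-- **`|shortStrings W| = 2^W − 1`** (`Σ_{ℓ<W} 2^ℓ`). [folklore] -/
theorem card_shortStrings (W : ℕ) : (shortStrings W).card = 2 ^ W - 1 := by
  classical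
  unfold shortStrings
  rw [Finset.card_biUnion]
  · have h : ∀ n ∈ Finset.range W,
        ((Finset.univ : Finset (Fin n → Bool)).image List.ofFn).card = 2 ^ n := fun n _ => by
      rw [Finset.card_image_of_injective _ List.ofFn_injective, Finset.card_univ, Fintype.card_fun,
        Fintype.card_bool, Fintype.card_fin]
    rw [Finset.sum_congr rfl h, sum_range_two_pow]
  · intro m _ n _ hmn
    rw [Function.onFun, Finset.disjoint_left]
    intro q hm hn
    simp only [Finset.mem_image, Finset.mem_univ, true_and] at hm hn
    obtain ⟨f, rfl⟩ := hm
    obtain ⟨g, hg⟩ := hn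
    have := congrArg List.length hg
    simp at this
    exact hmn this.symm

/-- The numbering restricted to the strings of length `< W`, into `Fin (2^W − 1)`. [folklore] -/
def strNumFin (W : ℕ) (s : OracleVar W) : Fin (2 ^ W - 1) :=
  ⟨strNum s.1, strNum_lt_of_length_lt (mem_shortStrings.1 s.2)⟩

/-- It is a bijection (injective between finite sets of the same size). [folklore] -/
theorem strNumFin_bijective (W : ℕ) : Function.Bijective (strNumFin W) := by
  classical
  have hinj : Function.Injective (strNumFin W) := fun s t h =>
    Subtype.ext (strNum_injective (by simpa [strNumFin] using congrArg Fin.val h))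
  refine (Fintype.bijective_iff_injective_and_card _).2 ⟨hinj, ?_⟩
  rw [Fintype.card_coe, card_shortStrings, Fintype.card_fin]

/-- **Enumerating the oracle variables by `Fin M`** through the canonical numbering `strNum`
(transported along `M = 2^W − 1`, `card_shortStrings`): variable `i` is the string `s` with
`strNum s = i` (`bitEquiv_apply`, `strNum_bitEquiv_symm`). [folklore] -/
def bitEquiv : OracleVar (oracleWidth F x) ≃ Fin (numOracleBits F x) :=
  (Equiv.ofBijective _ (strNumFin_bijective (oracleWidth F x))).trans
    (finCongr (card_shortStrings (oracleWidth F x)).symm)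

/-- The number of the variable `s` is `strNum s`. [folklore] -/
@[simp] theorem bitEquiv_apply (s : OracleVar (oracleWidth F x)) : ((bitEquiv F x s : Fin _) : ℕ) = strNum s.1 := rfl

/-- The string of the variable numbered `i` has number `i`. [folklore] -/
@[simp] theorem strNum_bitEquiv_symm (i : Fin (numOracleBits F x)) :
    strNum ((bitEquiv F x).symm i).1 = i := by
  have := bitEquiv_apply F x ((bitEquiv F x).symm i)
  rw [Equiv.apply_symm_apply] at this
  exact this.symm

/-- `M = 2^W − 1`. [folklore] -/
theorem numOracleBits_eq : numOracleBits F x = 2 ^ oracleWidth F x - 1 := card_shortStrings _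

/-- The variable numbered `i` is the unique short string `s` with `strNum s = i`. [folklore] -/
theorem bitEquiv_symm_eq_iff (i : Fin (numOracleBits F x)) (s : OracleVar (oracleWidth F x)) :
    (bitEquiv F x).symm i = s ↔ strNum s.1 = i := by
  rw [Equiv.symm_apply_eq]
  constructor
  · intro h; rw [h, bitEquiv_apply]
  · intro h; exact Fin.ext (by rw [bitEquiv_apply, h])

/-- The relevant bits of the oracle `A` (`restrictBool` of `RandomOracleCylinders.lean`), as a
point of `{0,1}^M`. [cite: AaronsonAmbainis2014, proof of Thm. 23 (the bits of B)] -/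
def oracleBits (A : Set (List Bool)) : Fin (numOracleBits F x) → Bool :=
  fun i => restrictBool (shortStrings (oracleWidth F x)) A ((bitEquiv F x).symm i)

/-- An oracle with prescribed relevant bits. [folklore] -/
def oracleOf (b : Fin (numOracleBits F x) → Bool) : Set (List Bool) :=
  {q | ∃ h : q ∈ shortStrings (oracleWidth F x), b (bitEquiv F x ⟨q, h⟩) = true}

/-- `oracleOf` is a right inverse of `oracleBits`. [folklore] -/
theorem oracleBits_oracleOf (b : Fin (numOracleBits F x) → Bool) : oracleBits F x (oracleOf F x b) = b := by
  funext i
  unfold oracleBits oracleOf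
  set u := (bitEquiv F x).symm i with hu
  apply Bool.eq_iff_iff.2
  rw [restrictBool_eq_true_iff]
  simp only [Set.mem_setOf_eq]
  constructor
  · rintro ⟨h, hb⟩
    have : bitEquiv F x ⟨u.1, h⟩ = i := by
      rw [show (⟨u.1, h⟩ : OracleVar (oracleWidth F x)) = u from Subtype.ext rfl, hu, Equiv.apply_symm_apply]
    rwa [this] at hb
  · intro hb
    refine ⟨u.2, ?_⟩
    rw [show (⟨u.1, u.2⟩ : OracleVar (oracleWidth F x)) = u from Subtype.ext rfl, hu, Equiv.apply_symm_apply]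
    exact hb

/-- **The acceptance polynomial of `F` at `x` over the enumerated oracle bits** (Lemma 20,
`exists_acceptPolynomialOn`, transported along the enumeration). [cite: AaronsonAmbainis2014, Lemma 20] -/
def acceptPoly : MvPolynomial (Fin (numOracleBits F x)) ℝ :=
  MvPolynomial.rename (bitEquiv F x) (Classical.choose (exists_acceptPolynomialOn F x))

/-- Degree `≤ 2 · #oracle gates`. [cite: AaronsonAmbainis2014, Lemma 20] -/
theorem totalDegree_acceptPoly_le :
    (acceptPoly F x).totalDegree ≤ 2 * (F.circ x.length).oracleQueries :=
  (MvPolynomial.totalDegree_rename_le _ _).trans (Classical.choose_spec (exists_acceptPolynomialOn F x)).1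

/-- **`p_x(A)` is the value of the acceptance polynomial at the relevant bits of `A`.** [cite: AaronsonAmbainis2014, Lemma 20 and proof of Thm. 23] -/
theorem evalBool_acceptPoly (A : Set (List Bool)) :
    evalBool (acceptPoly F x) (oracleBits F x A) = F.acceptProbOn A x := by
  rw [(Classical.choose_spec (exists_acceptPolynomialOn F x)).2 A]
  unfold evalBool acceptPoly
  rw [MvPolynomial.eval_rename, oraclePt_eq_restrictBool]
  exact congrArg (fun g => MvPolynomial.eval g _) (funext fun q => by simp [oracleBits])

/-- Over a unitary gate set the acceptance polynomial takes values in `[0, 1]` on the cube (every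
point of the cube is the bit pattern of some oracle). [folklore] -/
theorem acceptPoly_bounded (hG : G.IsUnitary) (b : Fin (numOracleBits F x) → Bool) :
    0 ≤ evalBool (acceptPoly F x) b ∧ evalBool (acceptPoly F x) b ≤ 1 := by
  rw [← oracleBits_oracleOf F x b, evalBool_acceptPoly]
  exact ⟨QCircuitFamily.acceptProbOn_nonneg _ _ _, QCircuit.acceptProb_le_one_holds hG _ _ _⟩

/-- **The relevant bits of the random oracle are uniform**: `μ {A | oracleBits A ∈ S} = |S| / 2^M`
(the bridge `randomOracleMeasure_restrictBool`, transported along the enumeration). [cite: BookVollmerWagner1996, §3 (p. 373)] -/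
theorem randomOracleMeasure_oracleBits_mem (S : Finset (Fin (numOracleBits F x) → Bool)) :
    randomOracleMeasure {A : Set (List Bool) | oracleBits F x A ∈ S} = S.card * 2⁻¹ ^ numOracleBits F x := by
  classical
  set U := shortStrings (oracleWidth F x) with hU
  set φ : (U → Bool) → (Fin (numOracleBits F x) → Bool) := fun τ i => τ ((bitEquiv F x).symm i) with hφ
  have hφinj : Function.Injective φ := by
    intro τ τ' h
    funext u
    have := congrFun h (bitEquiv F x u)
    simpa [hφ] using this
  set S' : Finset (U → Bool) := univ.filter fun τ => φ τ ∈ S with hS'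
  have hset : {A : Set (List Bool) | oracleBits F x A ∈ S} = {A | restrictBool U A ∈ S'} := by
    ext A
    simp only [Set.mem_setOf_eq, hS', mem_filter, mem_univ, true_and]
    exact Iff.rfl
  have hcard : S'.card = S.card := by
    have himage : S'.image φ = S := by
      ext b
      simp only [mem_image, hS', mem_filter, mem_univ, true_and]
      constructor
      · rintro ⟨τ, hτ, rfl⟩; exact hτ
      · intro hb
        refine ⟨fun u => b (bitEquiv F x u), ?_, ?_⟩
        · convert hb using 1
          funext i; simp [hφ]
        · funext i; simp [hφ]
    rw [← himage, Finset.card_image_of_injective _ hφinj]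
  rw [hset, randomOracleMeasure_restrictBool, hcard]
  rfl

end Bits

/-! ### Thm. 23, query form -/

/-- Arithmetic of the depth bound: for `n ≥ 1`, `20 n³ (2s + 1) + 1 ≤ 61 (s + n)^4`. [folklore] -/
theorem thm23_depth_arith {s n : ℕ} (hn : 1 ≤ n) :
    (20 : ℝ) * (n : ℝ) ^ 3 * (2 * s + 1) + 1 ≤ 61 * ((s : ℝ) + n) ^ 4 := by
  have hn' : (1 : ℝ) ≤ n := by exact_mod_cast hn
  have hs : (0 : ℝ) ≤ s := Nat.cast_nonneg s
  set u := (s : ℝ) + n with hu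
  have hu1 : 1 ≤ u := by rw [hu]; linarith
  have hnu : (n : ℝ) ≤ u := by rw [hu]; linarith
  have h1 : (n : ℝ) ^ 3 ≤ u ^ 3 := by gcongr
  have h2 : (2 * s + 1 : ℝ) ≤ 3 * u := by rw [hu]; linarith
  have hu4 : 1 ≤ u ^ 4 := one_le_pow₀ hu1
  calc (20 : ℝ) * (n : ℝ) ^ 3 * (2 * s + 1) + 1 ≤ 20 * u ^ 3 * (3 * u) + u ^ 4 := by
        gcongr
    _ = 61 * u ^ 4 := by ring

section Explicit

variable (c : ℕ) (C₀ : ℝ) (F : QCircuitFamily G) (x : List Bool)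

/-- The accuracy parameter `δ = 1/(2n³)` of the run of `C` on `p_x` (so that `δ < 1/n³`). [cite: AaronsonAmbainis2014, proof of Thm. 23 (claim (apx))] -/
def thm23Delta : ℝ := 1 / (2 * (x.length : ℝ) ^ 3)

/-- The degree bound `d = 2 · #oracle gates + 1 ≥ 1` used for `p_x`. [cite: AaronsonAmbainis2014, proof of Thm. 23 (degree poly(n))] -/
def thm23Degree : ℕ := 2 * (F.circ x.length).oracleQueries + 1

/-- **The simulation tree of the oracle machine `F` at input `x`**: Aaronson–Ambainis' algorithm
`C` (`ClassicalSimulation.simTree`) run on the acceptance polynomial `p_x = acceptPoly F x` with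
`ε = 1/10`, `δ = 1/(2n³)`, degree bound `d = thm23Degree F x`, for constants `c, C₀` of
Conjecture 6 (variance threshold `θ = ε²δ/2`, influence threshold `w = C₀ (θ/d)^c`, budget
`⌈8d/(wδ)⌉`, as in `ClassicalSimulation.simTree_depth_error_le`). A deterministic decision tree
over the `M` relevant oracle bits. [cite: AaronsonAmbainis2014, proof of Thm. 23 ("This C is essentially just the algorithm from Theorem 21")] -/
def simTreeOn : RealDecisionTree (numOracleBits F x) :=
  ClassicalSimulation.simTree ((1 / 10) ^ 2 * thm23Delta x / 2)
    (C₀ * (((1 / 10) ^ 2 * thm23Delta x / 2) / thm23Degree F x) ^ c)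
    (Nat.ceil (8 * (thm23Degree F x : ℝ) /
      ((C₀ * (((1 / 10) ^ 2 * thm23Delta x / 2) / thm23Degree F x) ^ c) * thm23Delta x)))
    (acceptPoly F x)

variable {c C₀ x}

/-- `δ > 0`. [folklore] -/
theorem thm23Delta_pos (hn : 1 ≤ x.length) : 0 < thm23Delta x := by
  unfold thm23Delta
  have : (0 : ℝ) < x.length := by exact_mod_cast hn
  positivity

/-- `δ ≤ 1`. [folklore] -/
theorem thm23Delta_le_one (hn : 1 ≤ x.length) : thm23Delta x ≤ 1 := by
  unfold thm23Delta
  have hn' : (1 : ℝ) ≤ x.length := by exact_mod_cast hn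
  rw [div_le_one (by positivity)]
  nlinarith [one_le_pow₀ (n := 3) hn']

/-- `δ < 1/n³`. [folklore] -/
theorem thm23Delta_lt (hn : 1 ≤ x.length) : thm23Delta x < 1 / (x.length : ℝ) ^ 3 := by
  unfold thm23Delta
  have hn' : (0 : ℝ) < x.length := by exact_mod_cast hn
  rw [div_lt_div_iff₀ (by positivity) (by positivity)]
  nlinarith [pow_pos hn' 3]

variable (x) in
/-- The explicit bounds for `simTreeOn`: depth `≤ (⌈16·4^c/C₀⌉ + 1) · 61^{4c+2} · (size + n)^{4(4c+2)}`
and `#{b ∈ {0,1}^M : |tree(b) − p_x(b)| > 1/10} ≤ δ 2^M`, for constants `c, C₀` satisfying the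
body of Conjecture 6. [cite: AaronsonAmbainis2014, Thm. 23 (proof, p. 14) via Thm. 21] -/
theorem simTreeOn_depth_error_le (hC₀ : 0 < C₀)
    (H : ∀ (N d : ℕ) (p : MvPolynomial (Fin N) ℝ) (ε : ℝ), 1 ≤ d → p.totalDegree ≤ d →
      (∀ y, 0 ≤ evalBool p y ∧ evalBool p y ≤ 1) → 0 < ε → ε ≤ boolVariance p →
        ∃ i : Fin N, C₀ * (ε / d) ^ c ≤ influence i p)
    (hG : G.IsUnitary) (hn : 1 ≤ x.length) :
    ((simTreeOn c C₀ F x).depth : ℝ) ≤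
        ((Nat.ceil (16 * 2 ^ c * 2 ^ c / C₀) + 1 : ℕ) : ℝ) * 61 ^ (4 * c + 2) *
          (((F.circ x.length).size : ℝ) + x.length) ^ (4 * (4 * c + 2)) ∧
      ((univ.filter fun b : Fin (numOracleBits F x) → Bool =>
          1 / 10 < |(simTreeOn c C₀ F x).eval b - evalBool (acceptPoly F x) b|).card : ℝ) ≤
        thm23Delta x * 2 ^ numOracleBits F x := by
  have hd1 : 1 ≤ thm23Degree F x := by unfold thm23Degree; omega
  have hdeg : (acceptPoly F x).totalDegree ≤ thm23Degree F x :=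
    (totalDegree_acceptPoly_le F x).trans (by unfold thm23Degree; omega)
  obtain ⟨hdepth, herr⟩ := ClassicalSimulation.simTree_depth_error_le hC₀ H hd1 hdeg
    (acceptPoly_bounded F x hG) (by norm_num : (0 : ℝ) < 1 / 10) (by norm_num) (thm23Delta_pos hn)
    (thm23Delta_le_one hn)
  refine ⟨?_, herr⟩
  refine hdepth.trans ?_
  have hoq : (F.circ x.length).oracleQueries ≤ (F.circ x.length).size := QCircuit.oracleQueries_le_size _
  have hbase : ((thm23Degree F x : ℕ) : ℝ) / (1 / 10 * thm23Delta x) + 1 ≤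
      61 * (((F.circ x.length).size : ℝ) + x.length) ^ 4 := by
    have hn' : (0 : ℝ) < x.length := by exact_mod_cast hn
    have e1 : ((thm23Degree F x : ℕ) : ℝ) / (1 / 10 * thm23Delta x) =
        20 * (x.length : ℝ) ^ 3 * (thm23Degree F x : ℕ) := by
      unfold thm23Delta; field_simp; ring
    rw [e1]
    unfold thm23Degree
    push_cast
    calc (20 : ℝ) * (x.length : ℝ) ^ 3 * (2 * ((F.circ x.length).oracleQueries : ℝ) + 1) + 1
        ≤ 20 * (x.length : ℝ) ^ 3 * (2 * ((F.circ x.length).size : ℝ) + 1) + 1 := by gcongr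
      _ ≤ 61 * (((F.circ x.length).size : ℝ) + x.length) ^ 4 := thm23_depth_arith hn
  have hnn : (0 : ℝ) ≤ ((thm23Degree F x : ℕ) : ℝ) / (1 / 10 * thm23Delta x) + 1 := by
    have := thm23Delta_pos hn
    positivity
  calc (((Nat.ceil (16 * 2 ^ c * 2 ^ c / C₀) + 1 : ℕ) : ℝ)) *
        (((thm23Degree F x : ℕ) : ℝ) / (1 / 10 * thm23Delta x) + 1) ^ (4 * c + 2)
      ≤ ((Nat.ceil (16 * 2 ^ c * 2 ^ c / C₀) + 1 : ℕ) : ℝ) *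
          (61 * (((F.circ x.length).size : ℝ) + x.length) ^ 4) ^ (4 * c + 2) := by gcongr
    _ = ((Nat.ceil (16 * 2 ^ c * 2 ^ c / C₀) + 1 : ℕ) : ℝ) * 61 ^ (4 * c + 2) *
          (((F.circ x.length).size : ℝ) + x.length) ^ (4 * (4 * c + 2)) := by
        rw [mul_pow, ← pow_mul]; ring

variable (x) in
/-- **`Pr_A[|p̃_x(A) − p_x(A)| > 1/10] < 1/n³` for the explicit tree `simTreeOn`** (the query
half of claim (apx), for constants of Conjecture 6). [cite: AaronsonAmbainis2014, Thm. 23 (proof, p. 14: claim (apx))] -/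
theorem measure_simTreeOn_deviation_lt (hC₀ : 0 < C₀)
    (H : ∀ (N d : ℕ) (p : MvPolynomial (Fin N) ℝ) (ε : ℝ), 1 ≤ d → p.totalDegree ≤ d →
      (∀ y, 0 ≤ evalBool p y ∧ evalBool p y ≤ 1) → 0 < ε → ε ≤ boolVariance p →
        ∃ i : Fin N, C₀ * (ε / d) ^ c ≤ influence i p)
    (hG : G.IsUnitary) (hn : 1 ≤ x.length) :
    randomOracleMeasure {A : Set (List Bool) |
        1 / 10 < |(simTreeOn c C₀ F x).eval (oracleBits F x A) - F.acceptProbOn A x|} <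
      ENNReal.ofReal (1 / (x.length : ℝ) ^ 3) := by
  classical
  obtain ⟨-, herr⟩ := simTreeOn_depth_error_le F x hC₀ H hG hn
  set t := simTreeOn c C₀ F x with ht
  have hset : {A : Set (List Bool) | 1 / 10 < |t.eval (oracleBits F x A) - F.acceptProbOn A x|} =
      {A : Set (List Bool) |
        oracleBits F x A ∈ univ.filter fun b => 1 / 10 < |t.eval b - evalBool (acceptPoly F x) b|} := by
    ext A
    simp only [Set.mem_setOf_eq, mem_filter, mem_univ, true_and, evalBool_acceptPoly]
  rw [hset, randomOracleMeasure_oracleBits_mem]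
  set S := univ.filter fun b : Fin (numOracleBits F x) → Bool =>
    1 / 10 < |t.eval b - evalBool (acceptPoly F x) b| with hS
  have hcard : (S.card : ℝ) ≤ thm23Delta x * 2 ^ numOracleBits F x := herr
  have hmeas : (S.card : ℝ≥0∞) * 2⁻¹ ^ numOracleBits F x =
      ENNReal.ofReal ((S.card : ℝ) / 2 ^ numOracleBits F x) := by
    rw [ENNReal.ofReal_div_of_pos (by positivity), ENNReal.ofReal_natCast, ENNReal.ofReal_pow (by norm_num),
      ENNReal.ofReal_ofNat, ← ENNReal.inv_pow, div_eq_mul_inv]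
  have hn' : (0 : ℝ) < x.length := by exact_mod_cast hn
  rw [hmeas, ENNReal.ofReal_lt_ofReal_iff (by positivity)]
  calc (S.card : ℝ) / 2 ^ numOracleBits F x ≤ thm23Delta x := by
        rw [div_le_iff₀ (by positivity)]; exact hcard
    _ < 1 / (x.length : ℝ) ^ 3 := thm23Delta_lt hn

variable (x) in
/-- **Thresholded form for the explicit tree** (Cor. 22: "output `1` if `p̃ ≥ 1/2`"): the event
of claim (apx) — the `BQP` promise holds for `F^A` at `x` but the bit `[p̃_x(A) ≥ 1/2]` is not
the promised answer — has probability `< 1/n³`. What (apx) asserts beyond this is that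
`A, x ↦ [ (simTreeOn c C₀ F x).eval (oracleBits F x A) ≥ 1/2 ]` is computed by a polynomial-TIME
oracle machine (under `P = P^{#P}`, for uniform `F`). [cite: AaronsonAmbainis2014, Thm. 23 (proof, p. 14) with proof of Cor. 22] -/
theorem measure_simTreeOn_threshold_lt (hC₀ : 0 < C₀)
    (H : ∀ (N d : ℕ) (p : MvPolynomial (Fin N) ℝ) (ε : ℝ), 1 ≤ d → p.totalDegree ≤ d →
      (∀ y, 0 ≤ evalBool p y ∧ evalBool p y ≤ 1) → 0 < ε → ε ≤ boolVariance p →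
        ∃ i : Fin N, C₀ * (ε / d) ^ c ≤ influence i p)
    (hG : G.IsUnitary) (hn : 1 ≤ x.length) :
    randomOracleMeasure {A : Set (List Bool) |
        (2 / 3 ≤ F.acceptProbOn A x ∧
            decide (1 / 2 ≤ (simTreeOn c C₀ F x).eval (oracleBits F x A)) ≠ true) ∨
          (F.acceptProbOn A x ≤ 1 / 3 ∧
            decide (1 / 2 ≤ (simTreeOn c C₀ F x).eval (oracleBits F x A)) ≠ false)} <
      ENNReal.ofReal (1 / (x.length : ℝ) ^ 3) := by
  refine lt_of_le_of_lt (measure_mono fun A hA => ?_) (measure_simTreeOn_deviation_lt F x hC₀ H hG hn)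
  simp only [Set.mem_setOf_eq, ne_eq, decide_eq_true_eq, decide_eq_false_iff_not, not_le, not_lt] at hA ⊢
  rcases hA with ⟨hp, ht⟩ | ⟨hp, ht⟩
  · rw [abs_sub_comm, abs_of_nonneg (by linarith)]; linarith
  · rw [abs_of_nonneg (by linarith)]; linarith

end Explicit

/-- **Aaronson–Ambainis 2014, Thm. 23 — the query-efficient half of claim (apx)**: assume the
Aaronson–Ambainis conjecture. There are constants `C, k` such that for every circuit family `F`
over a unitary gate set (with oracle gates) and every input `x` of length `n ≥ 1` there is a
deterministic decision tree over the `M` relevant oracle bits (namely `simTreeOn c C₀ F x` for the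
conjecture's constants), of depth `≤ C (size(F.circ n) + n)^k` (so `poly(n)` queries to `A` for
polynomial-size families), whose output `p̃_x(A)` satisfies `Pr_A[|p̃_x(A) − p_x(A)| > 1/10] < 1/n³`
for the random oracle `A`. [cite: AaronsonAmbainis2014, Thm. 23 (proof, p. 14: claim (apx) via Thm. 21 and Lemma 20)] -/
theorem aaronsonAmbainis2014_thm23_queries (hAA : AAConjecture) (hG : G.IsUnitary) :
    ∃ C k : ℕ, ∀ (F : QCircuitFamily G) (x : List Bool), 1 ≤ x.length →
      ∃ t : RealDecisionTree (numOracleBits F x),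
        (t.depth : ℝ) ≤ C * (((F.circ x.length).size : ℝ) + x.length) ^ k ∧
        randomOracleMeasure {A : Set (List Bool) |
            1 / 10 < |t.eval (oracleBits F x A) - F.acceptProbOn A x|} <
          ENNReal.ofReal (1 / (x.length : ℝ) ^ 3) := by
  obtain ⟨c, C₀, hC₀, H⟩ := hAA
  refine ⟨(Nat.ceil (16 * 2 ^ c * 2 ^ c / C₀) + 1) * 61 ^ (4 * c + 2), 4 * (4 * c + 2),
    fun F x hn => ⟨simTreeOn c C₀ F x, ?_, measure_simTreeOn_deviation_lt F x hC₀ H hG hn⟩⟩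
  have h := (simTreeOn_depth_error_le F x hC₀ H hG hn).1
  push_cast at h ⊢
  linarith

/-- **Thresholded form** (Cor. 22: "output `1` if `p̃ ≥ 1/2`"): with the same trees, the event
of claim (apx) — the `BQP` promise holds for `F^A` at `x` but the bit `[p̃_x(A) ≥ 1/2]` is not
the promised answer — has probability `< 1/n³`. [cite: AaronsonAmbainis2014, Thm. 23 (proof, p. 14) with proof of Cor. 22] -/
theorem aaronsonAmbainis2014_thm23_queries_threshold (hAA : AAConjecture) (hG : G.IsUnitary) :
    ∃ C k : ℕ, ∀ (F : QCircuitFamily G) (x : List Bool), 1 ≤ x.length →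
      ∃ t : RealDecisionTree (numOracleBits F x),
        (t.depth : ℝ) ≤ C * (((F.circ x.length).size : ℝ) + x.length) ^ k ∧
        randomOracleMeasure {A : Set (List Bool) |
            (2 / 3 ≤ F.acceptProbOn A x ∧ decide (1 / 2 ≤ t.eval (oracleBits F x A)) ≠ true) ∨
            (F.acceptProbOn A x ≤ 1 / 3 ∧ decide (1 / 2 ≤ t.eval (oracleBits F x A)) ≠ false)} <
          ENNReal.ofReal (1 / (x.length : ℝ) ^ 3) := by
  obtain ⟨c, C₀, hC₀, H⟩ := hAA
  refine ⟨(Nat.ceil (16 * 2 ^ c * 2 ^ c / C₀) + 1) * 61 ^ (4 * c + 2), 4 * (4 * c + 2),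
    fun F x hn => ⟨simTreeOn c C₀ F x, ?_, measure_simTreeOn_threshold_lt F x hC₀ H hG hn⟩⟩
  have h := (simTreeOn_depth_error_le F x hC₀ H hG hn).1
  push_cast at h ⊢
  linarith

end Literature.Computability.QuantumComplexity

end
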